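import Mathlib
import Literature.MathematicalPhysics.QuantumFieldTheory.Balaban1983to89.B8Eq191Hprime

/-!
# `Balaban1983to89.B8Eq194FirstTerm` — T. Bałaban, *Spaces of regular gauge field configurations on a lattice and gauge
# fixing conditions*, Commun. Math. Phys. **99** (1985) 75–102 [Balaban1985RegularSpaces], p. 92: the rewriting of the
# first term of (1.93) as (1.94) «because RΔλ = Δλ for λ satisfying Q′λ = 0» — the EXACT identity behind it (with the
# second-order term it leaves to 𝔉₄ displayed), and the two right inverses of Q′ involved: the H′ of (1.91) and the
# H′ of [4] (3.163)–(3.164), compared (kernel-checked; located reading, constants only)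

statement-level skeleton of published theorems with citation tags; proofs where landed; nothing here is a claim about the Yang–Mills mass gap

PDF held: `paper:balaban1985-cmp99-regular-spaces-gauge-fixing` (journal page = PDF page + 74).  Pages read for this
module AS IMAGES: renders `run/shared/lean/pub/pub-balaban/b2b-balaban-ref1/pages/1985-cmp99-regular-spaces-gauge-fixing/
…-p017-x2.png`, `…-p018-x2.png`, `…-p019-x2.png` (pp. 91–93); [4] = T. Bałaban, *Propagators for lattice gauge theories in a
background field*, Commun. Math. Phys. **99** (1985) 389–434 [Balaban1985BackgroundPropagators], p. 429 [PDF 41] (render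
`…/1985-cmp99-background-propagators/…-p041-x2.png`, read as image) and pp. 394, 416 through the tree modules
`B9Eq325Proj`, `B9Thm311Data` (audit cell `pub-balaban`) and `B8Eq191Hprime` (r05).

CITATION HEADER (lean-in-tree rule).  Cell `lit-balaban`, Phase-2 proof seat p40 gen 7; SKELETON rows **B8.Eq1.95**
((1.93)–(1.96) p. 92, head «proved-existing»: the ring identities `B8.landau_projection_identities` and the Neumann
inversion `B8SectDSource.*`) — THIS MODULE ADDS the operator identity behind the sentence «The first term in the first
equation can be written as (1.94) because RΔλ = Δλ for λ satisfying Q′λ = 0», with the term it does not display made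
explicit — and the cross-paper edge B8 (1.91) p. 91 «They were investigated in [4]» ↔ **B9.Eq3.162** ([4]
(3.162)–(3.165) p. 429, head «proved-existing», matrix kernels `B9H163.*` of the audit cell): the operator (1.91) and the
operator (3.163) = (3.164) of [4] are BOTH right inverses of Q′, and they are compared here in the common vocabulary of
[4]'s (3.25)-data (`B9Eq325Proj.Data`).  Kind: theorems over the printed inputs + ONE definition with body (`H4`, the
(3.163) operator over `Data`; its matrix twin is `B9H163.H163`, declared TWIN BY DESIGN: same printed formula, other
carrier) + a six-site witness; no `… : Prop` fact is introduced; 0 sorry.  r05 gen 10's `B8Eq191Hprime.Hp` (= (1.91)) is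
consumed BY NAME; nothing of it is restated.

WHAT IS PRINTED (verbatim).
* B8 p. 91 [PDF 17], (1.90): *"Rg(i ad_λ)D\*Dλ + Re^{−i ad_λ}D\*A + R𝔉₃(λ, Dλ, A) = 0, Q′(u₁, λ) = 0. (1.90)"*; *"If it was
  equal to Q′λ, then D\*Dλ = Δλ would belong to the subspace R = ΔN(Q′) and we would have Rg(i ad_λ)Δλ = RΔλ + O(α₄)Δλ =
  (Δ + Q′\*aQ′)λ + O(α₄)Δλ."*; (1.91): *"H′ = G′²Q′\*(Q′G′²Q′\*)⁻¹, G′ = (Δ + Q′\*aQ′)⁻¹. (1.91) They were investigated in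
  [4], …"*.
* B8 p. 92 [PDF 18]: *"In the next section we will prove that for α₃, α₄ sufficiently small there exists a function
  D′(u₁, λ) such that the change of variables λ → λ − H′D′(u₁, λ) transforms the function Q′(u₁, λ) into Q′λ. … This change
  of variables applied to Eqs. (1.90) gives the following equations
  Rg(i ad_{λ−H′D′(u₁,λ)})Δ(λ − H′D′(u₁, λ)) − R exp(−i ad_{λ−H′D′(u₁,λ)})D\*A − R𝔉₃(λ − H′D′(u₁, λ), Dλ − DH′D′(u₁, λ), A) = 0,
  Q′λ = 0. (1.93)  The first term in the first equation can be written as [I + R[g(i ad_{λ−H′D′(u₁,λ)}) − 1]R]Δλ, (1.94)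
  because RΔλ = Δλ for λ satisfying Q′λ = 0. … Multiplying Eq. (1.93) by an inverse operator we obtain the equations
  Δλ − RD\*A − R𝔉₄(λ, Dλ, A, D\*A) = 0, Q′λ = 0. (1.95)"*; p. 93 [PDF 19], before (1.99): *"We get the same bound for the
  term with D\*A (but with RD\*A subtracted), and with ΔH′D′(u₁, λ). Thus we have the bound |R𝔉₄(λ, Dλ, A, D\*A)| ≦
  C′₄B₁(α₀ + α₁)α₄(L^jη)⁻² on Ω_j (1.99)"*.
* [4] p. 394 [PDF 6]: *"R = R(U) is an orthogonal projection in the Hilbert space L²(Ω₀, 𝔤) onto the subspace R =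
  Δ^η_U N(Q′), N(Q′) = {λ : Q′λ = 0}. (3.21)"*, *"Rf = (I − G′Q′\*(Q′G′²Q′\*)⁻¹Q′G′)f, (3.25) where G′ = G′(U) = (Δ′_a)⁻¹"*,
  Δ′_a = Δ^η_U + Q′\*aQ′ (3.24) — typed in `B9Eq325Proj` (`R325`, `lapA`, `lapKer`, `Data`).
* [4] p. 429 [PDF 41]: *"We make a translation λ = λ′ + λ₀ such that Q′λ − μ = Q′λ′, i.e. Q′λ₀ = μ, and RΔλ₀ = 0. To find
  such λ₀ we make use of the last equation. The formula (3.25) for R implies Δλ₀ − G′Q′\*(Q′G′²Q′\*)⁻¹(Q′λ₀ −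
  aQ′G′Q′\*Q′λ₀) = 0, (3.162) and the condition Q′λ₀ = μ yields λ₀ = G′²Q′\*(Q′G′²Q′\*)⁻¹(μ − aQ′G′Q′\*μ) + aG′Q′\*μ. (3.163)
  Thus the configuration λ₀ is determined uniquely by the two conditions. It is easy to verify that the operator on the
  right-hand side of (3.163) is equal to the operator H′μ = (Z′(μ))⁻¹∫dλ δ(Q′λ − μ)e^{−(1/2)‖Δλ‖²}. (3.164) The translation
  λ = λ′ + H′μ changes the expressions dependent on λ in (3.161) in the following way δ(Q′λ − μ) = δ(Q′λ), …,
  RΔλ = RΔλ′ = Δλ′, Dλ = Dλ′ + DH′μ. (3.165)"*.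

WHAT THIS MODULE PROVES (§1 abstract, over `B9Eq325Proj.Data Δ q qs A g c`: E ⊇ L²(Ω₀, 𝔤), F = L²(𝔅_k) real inner-product
spaces; Δ = Δ^η_{U₀} = D\*D, q = Q′, qs = Q′\*, A = a (LEVEL-DEPENDENT, as (3.24) prints a_j), g = G′ = (Δ′_a)⁻¹,
c = (Q′G′²Q′\*)⁻¹, `R325` = R of (3.25), `Hp` = H′ of (1.91) [r05]):
1. `lap_Hp`, `R_lapA_Hp`, **`R_lap_Hp`** — for the H′ of (1.91): Δ′_aH′X = G′Q′\*(Q′G′²Q′\*)⁻¹X and RΔ′_aH′ = 0, but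
   ΔH′X = G′Q′\*(Q′G′²Q′\*)⁻¹X − Q′\*aX and **RΔH′ = −RQ′\*a** (exact).
2. **`firstTerm_eq`** — the identity behind (1.94): for λ with Q′λ = 0, ANY linear operator M on L²(Ω₀, 𝔤) (print: the
   fibrewise multiplier M = g(i ad_{λ−H′D′(u₁,λ)})) and ANY h ∈ L²(Ω₀, 𝔤) (print: h = H′D′(u₁, λ)),
   R M Δ(λ − h) = [I + R(M − I)R]Δλ − R M Δ h — the first summand IS the display (1.94) (`printed194`) and rests exactly on
   the printed reason RΔλ = Δλ (`Data.R325_lap`); the second summand −R M ΔH′D′ is NOT displayed on p. 92 and is the term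
   p. 93 bounds («and with ΔH′D′(u₁, λ)») inside R𝔉₄ of (1.95)/(1.99).  `rewriting194_iff`: the display holds literally iff
   R M ΔH′D′ = 0; `rewriting194_id_iff`: at M = I (first order in ad, or abelian 𝔤) iff RQ′\*aD′ = 0.
3. **`H4`** — the operator of [4] (3.163)–(3.164) over the same data, H′₍₄₎μ := H′(μ − Q′G′Q′\*aμ) + G′Q′\*aμ (the printed
   scalar a generalised to the operator a of (3.24) in the only placement for which (3.162) is solved); `q_H4` (Q′H′₍₄₎ = I),
   `lap_H4` (ΔH′₍₄₎μ = G′Q′\*(Q′G′²Q′\*)⁻¹(μ − Q′G′Q′\*aμ)), **`R_lap_H4`** (RΔH′₍₄₎ = 0 — the defining condition «RΔλ₀ = 0»,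
   matrix twin `B9H163.R_mul_Δ_mul_H163`), hence **`rewriting194_H4`**: with [4]'s operator the translation satisfies
   (3.165) «RΔλ = RΔλ′ = Δλ′» and the M = I form of (1.94) is EXACT; `firstTerm_H4` displays the residual R(M − I)ΔH′₍₄₎D′ for
   general M; `inner_lap_H4_lap_eq_zero`, `norm_lap_sq_eq_add_H4`, `norm_lap_H4_sq_le`, `eq_H4_of_isMin` — H′₍₄₎μ minimises
   ‖Δλ‖² on {Q′λ = μ} ((3.164): the Gaussian mean of e^{−½‖Δλ‖²} on the slice, `B9H163.h164_mean`/`isMinimiser`), unique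
   when Δ is injective on N(Q′); whereas H′μ of (1.91) minimises ‖Δ′_aλ‖² on the same slice (r05
   `B8Eq191Hprime.norm_lapA_Hp_sq_le`).  `H4_sub_Hp`, `q_H4_sub_Hp`: H′₍₄₎ − H′ = (I − H′Q′)G′Q′\*a ranges in N(Q′).
4. **`forall_R_qs_eq_zero_iff`** — RQ′\* = 0 ⟺ Q′ΔN(Q′) = 0 (Δ maps N(Q′) into N(Q′)); `g_qs_eq_Hp_of_criterion`,
   **`H4_eq_Hp_of_criterion`**, `criterion_of_H4_eq_Hp` — the two right inverses COINCIDE iff that criterion holds (for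
   a onto, e.g. a_j > 0 in finite dimension); `R_lap_Hp_eq_zero_iff` — iff RΔH′ = 0 for (1.91)'s H′.
§2 WITNESS (`Witness6`): the criterion FAILS already on the smallest periodic two-block system — d = 1, torus of 6 sites
(η-lattice), L = 3, two unit-lattice points (blocks {0,1,2}, {3,4,5}), flat background U₀ = 1, 𝔤 = ℝ, a = 1: the (3.25)
data EXIST (`exists_data6`, from `B9Thm311Data.exists_data_of_ingredients`), λ = δ₀ − δ₁ has Q′λ = 0 and (Q′Δλ)(first
block) = 1/3 ≠ 0 (`criterion_fails6`); hence for every such data RQ′\* ≠ 0 (`exists_R_qs_ne_zero6`), RΔH′ ≠ 0 for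
(1.91)'s H′ (`exists_R_lap_Hp_ne_zero6`), H′ ≠ H′₍₄₎ (`exists_Hp_ne_H4_6`), and the display (1.94) (M = I, λ = 0, D′ = X)
differs from the first term of (1.93) (`rewriting194_fails6`).  (By hand, not kernel-checked: the same happens for the
Dirichlet three-site block of [4] p. 394 — λ = (1, −2, 1), Q′Δλ = 2/3 — and in every d; it does NOT happen when no bond
of Δ joins two blocks or leaves Ω₀, e.g. on the audit cell's `B9BlockSystem1D` carriers, where Q′Δ = 0 on N(Q′).)

READING RECORDED (cell GAPS G-B8-19; located, constants only — NOT an error of the paper).  (a) The p. 92 sentence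
rewrites only the RΔλ-part of the first term of (1.93); the remaining part −R g(i ad)ΔH′D′(u₁, λ) is of second order
(|D′| ≦ C′₂(α₃ + α₄)α₄ by (1.121)) and is carried by 𝔉₄: p. 93 says so («and with ΔH′D′(u₁, λ)»), and the audit cell's
G-B8-12 records that its bound needs the ΔH′-entry of [4] (not among the two entries displayed in (1.92)).  (b) «They were
investigated in [4]»: the operator [4] calls H′ ((3.164) = (3.163)) is NOT the operator (1.91) unless Q′ΔN(Q′) = 0, which
fails as soon as a bond of Δ joins two blocks (§2); both are right inverses of Q′ — the only property Sect. E uses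
((1.115) ⇒ (1.116), r05 `q_Hp`) — and the (1.92)-type bounds follow for either from Theorems 3.1–3.2 of [4] (`B8Ineq192`);
with [4]'s operator the dropped term of (a) would reduce to −R[g(i ad) − 1]ΔH′₍₄₎D′ (`firstTerm_H4`).  Nothing downstream
changes; the note fixes which operator each display is about.

HONEST SCOPE.  (i) No bound is proved here ((1.92), (1.97)–(1.99) are `B8Ineq192`/`B8Ineq197`/`B8SectDSource` business);
"second order" above is the printed bookkeeping, quoted, not certified.  (ii) M is an arbitrary linear operator on E; that
g(i ad_{λ′}) − 1 is fibrewise and O(α₄) (p. 92 «|V| ≦ O(α₄)») is not used.  (iii) The witness is d = 1 (no plaquettes);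
it bears only on the linear algebra of Δ, Q′, R, H′, which is dimension-blind; weights as in `B9Thm311Lattice` (unweighted
ℓ², cell DIVERGENCE D-b09.24).  (iv) `H4` generalises the printed scalar a of (3.163) to the operator a of (3.24); for
scalar a it is literally (3.163) (`H4_apply`).  Value = kernel-checked dictionary between two displays of two papers and
one located reading note; NOT summit progress.
-/

namespace Literature.MathematicalPhysics.QuantumFieldTheory.Balaban1983to89.B8Eq194FirstTerm

open B5Projector144 B9Eq325Proj B9Thm311Data B8Eq191Hprime
open scoped InnerProductSpace

noncomputable section

/-! ## §1  Abstract: over the (3.25)-data of [4] -/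

section Abstract

variable {E F : Type*} [NormedAddCommGroup E] [InnerProductSpace ℝ E] [NormedAddCommGroup F]
  [InnerProductSpace ℝ F]

section Defs

variable (Δ : E →ₗ[ℝ] E) (q : E →ₗ[ℝ] F) (qs : F →ₗ[ℝ] E) (A : F →ₗ[ℝ] F) (g : E →ₗ[ℝ] E) (c : F →ₗ[ℝ] F)

/-- **(1.94) as displayed**: «[I + R[g(i ad_{λ−H′D′(u₁,λ)}) − 1]R]Δλ», with `M` standing for the fibrewise multiplier
g(i ad_{λ−H′D′(u₁,λ)}) (any linear operator here) and `R325` = R of [4] (3.25).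
[cite: Balaban1985RegularSpaces, (1.94) p.92] -/
def printed194 (M : E →ₗ[ℝ] E) (l : E) : E :=
  Δ l + R325 q qs g c ((M - LinearMap.id : E →ₗ[ℝ] E) (R325 q qs g c (Δ l)))

/-- unfolding of `printed194`. [cite: Balaban1985RegularSpaces, (1.94) p.92] -/
theorem printed194_def (M : E →ₗ[ℝ] E) (l : E) :
    printed194 Δ q qs g c M l =
      Δ l + R325 q qs g c ((M - LinearMap.id : E →ₗ[ℝ] E) (R325 q qs g c (Δ l))) := rfl

/-- **[4] (3.163)–(3.164)**: the right inverse of Q′ that [4] calls H′ — «λ₀ = G′²Q′\*(Q′G′²Q′\*)⁻¹(μ − aQ′G′Q′\*μ) + aG′Q′\*μ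
(3.163) … equal to the operator H′μ = (Z′(μ))⁻¹∫dλ δ(Q′λ − μ)e^{−(1/2)‖Δλ‖²} (3.164)» — written with r05's `Hp` = G′²Q′\*(Q′G′²Q′\*)⁻¹
(= B8 (1.91)) and with the scalar a of the display generalised to the operator a of (3.24) (placed where (3.162) is
solved: μ − Q′G′Q′\*aμ, G′Q′\*aμ).  TWIN BY DESIGN of the audit cell's matrix kernel `B9H163.H163` (same printed formula on
`Matrix` carriers, scalar a). [cite: Balaban1985BackgroundPropagators, (3.162)–(3.164) p.429] -/
def H4 : F →ₗ[ℝ] E :=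
  Hp qs g c ∘ₗ (LinearMap.id - q ∘ₗ g ∘ₗ qs ∘ₗ A) + g ∘ₗ qs ∘ₗ A

/-- unfolding of (3.163): H′₍₄₎μ = H′(μ − Q′G′Q′\*aμ) + G′Q′\*aμ. [cite: Balaban1985BackgroundPropagators, (3.163) p.429] -/
theorem H4_apply (μ : F) :
    H4 q qs A g c μ = Hp qs g c (μ - q (g (qs (A μ)))) + g (qs (A μ)) := rfl

end Defs

variable {Δ : E →ₗ[ℝ] E} {q : E →ₗ[ℝ] F} {qs : F →ₗ[ℝ] E} {A : F →ₗ[ℝ] F} {g : E →ₗ[ℝ] E} {c : F →ₗ[ℝ] F}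

/-! ### 1. The H′ of (1.91) against Δ = D\*D and against R -/

/-- ΔG′y = y − Q′\*aQ′G′y (Δ′_a = Δ + Q′\*aQ′ and Δ′_aG′ = I). [cite: Balaban1985BackgroundPropagators, (3.24) p.394] -/
theorem lap_g (h : Data Δ q qs A g c) (y : E) : Δ (g y) = y - qs (A (q (g y))) := by
  have h1 := h.g_right y
  rw [lapA_apply] at h1
  exact eq_sub_of_add_eq h1

/-- For the H′ of **(1.91)**: ΔH′X = G′Q′\*(Q′G′²Q′\*)⁻¹X − Q′\*aX (Δ = D\*D = Δ′_a − Q′\*aQ′, and Q′G′²Q′\*(Q′G′²Q′\*)⁻¹ = I).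
[cite: Balaban1985RegularSpaces, (1.91) p.91] -/
theorem lap_Hp (h : Data Δ q qs A g c) (X : F) : Δ (Hp qs g c X) = g (qs (c X)) - qs (A X) := by
  rw [Hp_apply, lap_g h, ← Hp_apply qs g c X, q_Hp h]

/-- R annihilates G′Q′\*(Q′G′²Q′\*)⁻¹X: R(G′Q′\*CX) = G′Q′\*CX − G′Q′\*C(Q′G′²Q′\*)CX = 0.
[cite: Balaban1985BackgroundPropagators, (3.25) p.394] -/
theorem R_g_qs_c (h : Data Δ q qs A g c) (X : F) : R325 q qs g c (g (qs (c X))) = 0 := by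
  rw [R325_apply, ← Hp_apply qs g c X, q_Hp h, sub_self]

/-- RΔ′_aH′ = 0 for the H′ of (1.91) (Δ′_aH′X = G′Q′\*(Q′G′²Q′\*)⁻¹X, r05 `lapA_Hp`).
[cite: Balaban1985RegularSpaces, (1.91) p.91; Balaban1985BackgroundPropagators, (3.25) p.394] -/
theorem R_lapA_Hp (h : Data Δ q qs A g c) (X : F) : R325 q qs g c (lapA Δ q qs A (Hp qs g c X)) = 0 := by
  rw [lapA_Hp h, R_g_qs_c h]

/-- **RΔH′ = −RQ′\*a** (exact) for the H′ of (1.91) and Δ = D\*D: the H′D′-part of the first term of (1.93) is NOT killed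
by R (compare `R_lap_H4`). [cite: Balaban1985RegularSpaces, (1.91) p.91, (1.93)–(1.94) p.92] -/
theorem R_lap_Hp (h : Data Δ q qs A g c) (X : F) :
    R325 q qs g c (Δ (Hp qs g c X)) = -R325 q qs g c (qs (A X)) := by
  rw [lap_Hp h, map_sub, R_g_qs_c h, zero_sub]

/-! ### 2. The identity behind (1.94) -/

/-- R M Δλ = [I + R(M − I)R]Δλ for Q′λ = 0 — the part of the first term of (1.93) that the display (1.94) rewrites,
«because RΔλ = Δλ for λ satisfying Q′λ = 0». [cite: Balaban1985RegularSpaces, (1.94) p.92] -/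
theorem R_M_lap_eq_printed194 (h : Data Δ q qs A g c) (M : E →ₗ[ℝ] E) (l : E) (hl : q l = 0) :
    R325 q qs g c (M (Δ l)) = printed194 Δ q qs g c M l := by
  have hR : R325 q qs g c (Δ l) = Δ l := h.R325_lap l hl
  have hM : M (Δ l) = Δ l + (M - LinearMap.id : E →ₗ[ℝ] E) (Δ l) := by
    rw [LinearMap.sub_apply, LinearMap.id_apply, add_sub_cancel]
  rw [printed194_def, hM, map_add, hR]

/-- **The identity behind (1.94).**  For λ with Q′λ = 0, any linear M (print: g(i ad_{λ−H′D′(u₁,λ)})) and any h (print: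
H′D′(u₁, λ)): the first term of (1.93) is  R M Δ(λ − h) = [I + R(M − I)R]Δλ − R M Δh  — the display (1.94) MINUS the
undisplayed term R M ΔH′D′(u₁, λ), which p. 93 carries in 𝔉₄ («and with ΔH′D′(u₁, λ)»).
[cite: Balaban1985RegularSpaces, (1.93)–(1.94) p.92, p.93 (before (1.99))] -/
theorem firstTerm_eq (h : Data Δ q qs A g c) (M : E →ₗ[ℝ] E) (l x : E) (hl : q l = 0) :
    R325 q qs g c (M (Δ (l - x))) = printed194 Δ q qs g c M l - R325 q qs g c (M (Δ x)) := by
  rw [map_sub, map_sub, map_sub, R_M_lap_eq_printed194 h M l hl]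

/-- The display (1.94) is LITERALLY the first term of (1.93) iff R M ΔH′D′ = 0 (any h in place of H′D′).
[cite: Balaban1985RegularSpaces, (1.93)–(1.94) p.92] -/
theorem rewriting194_iff (h : Data Δ q qs A g c) (M : E →ₗ[ℝ] E) (l x : E) (hl : q l = 0) :
    R325 q qs g c (M (Δ (l - x))) = printed194 Δ q qs g c M l ↔ R325 q qs g c (M (Δ x)) = 0 := by
  rw [firstTerm_eq h M l x hl, sub_eq_self]

/-- At M = I the display (1.94) reads Δλ. [cite: Balaban1985RegularSpaces, (1.94) p.92] -/
theorem printed194_id (l : E) : printed194 Δ q qs g c LinearMap.id l = Δ l := by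
  rw [printed194_def, sub_self, LinearMap.zero_apply, map_zero, add_zero]

/-- At M = I (first order in ad, or abelian 𝔤) and h = H′X with the H′ of (1.91): the display (1.94) is literally the
first term iff RQ′\*aX = 0 (`R_lap_Hp`). [cite: Balaban1985RegularSpaces, (1.91) p.91, (1.93)–(1.94) p.92] -/
theorem rewriting194_id_iff (h : Data Δ q qs A g c) (l : E) (X : F) (hl : q l = 0) :
    R325 q qs g c (Δ (l - Hp qs g c X)) = Δ l ↔ R325 q qs g c (qs (A X)) = 0 := by
  have h1 := rewriting194_iff h LinearMap.id l (Hp qs g c X) hl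
  rw [printed194_id, LinearMap.id_apply, LinearMap.id_apply] at h1
  rw [h1, R_lap_Hp h, neg_eq_zero]

/-! ### 3. The H′ of [4] (3.163)–(3.165) -/

/-- Q′H′₍₄₎ = I: the operator of (3.163) is a right inverse of Q′ («Q′λ₀ = μ»).
[cite: Balaban1985BackgroundPropagators, (3.162)–(3.163) p.429] -/
theorem q_H4 (h : Data Δ q qs A g c) (μ : F) : q (H4 q qs A g c μ) = μ := by
  rw [H4_apply, map_add, q_Hp h, sub_add_cancel]

/-- ΔH′₍₄₎μ = G′Q′\*(Q′G′²Q′\*)⁻¹(μ − Q′G′Q′\*aμ): the a-terms of (3.163) cancel the Q′\*a-part of ΔG′² exactly.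
[cite: Balaban1985BackgroundPropagators, (3.162)–(3.163) p.429] -/
theorem lap_H4 (h : Data Δ q qs A g c) (μ : F) :
    Δ (H4 q qs A g c μ) = g (qs (c (μ - q (g (qs (A μ)))))) := by
  rw [H4_apply, map_add, lap_Hp h, lap_g h, map_sub A, map_sub qs]
  abel

/-- **RΔH′₍₄₎ = 0** — the defining condition «RΔλ₀ = 0» of (3.162), for the operator (3.163) over the (3.25) data with
level-dependent a (matrix twin: `B9H163.R_mul_Δ_mul_H163`). [cite: Balaban1985BackgroundPropagators, (3.162)–(3.163) p.429] -/
theorem R_lap_H4 (h : Data Δ q qs A g c) (μ : F) : R325 q qs g c (Δ (H4 q qs A g c μ)) = 0 := by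
  rw [lap_H4 h, R_g_qs_c h]

/-- **(3.165) «RΔλ = RΔλ′ = Δλ′»**: translating λ′ ∈ N(Q′) by H′₍₄₎μ does not change RΔ — i.e. with [4]'s operator in
place of (1.91)'s, the M = I form of the display (1.94) is EXACT. [cite: Balaban1985BackgroundPropagators, (3.165) p.429; Balaban1985RegularSpaces, (1.94) p.92] -/
theorem rewriting194_H4 (h : Data Δ q qs A g c) (l : E) (μ : F) (hl : q l = 0) :
    R325 q qs g c (Δ (l - H4 q qs A g c μ)) = Δ l := by
  rw [map_sub, map_sub, h.R325_lap l hl, R_lap_H4 h, sub_zero]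

/-- The same for `+`: RΔ(λ′ + H′₍₄₎μ) = Δλ′ for λ′ ∈ N(Q′) (the printed direction of the translation λ = λ′ + H′μ).
[cite: Balaban1985BackgroundPropagators, (3.165) p.429] -/
theorem R_lap_add_H4 (h : Data Δ q qs A g c) (l : E) (μ : F) (hl : q l = 0) :
    R325 q qs g c (Δ (l + H4 q qs A g c μ)) = Δ l := by
  rw [map_add, map_add, h.R325_lap l hl, R_lap_H4 h, add_zero]

/-- With [4]'s operator and a general multiplier M the first term of (1.93) is (1.94) minus the residual
R(M − I)ΔH′₍₄₎D′ only (the RΔH′₍₄₎D′-part vanishes). [cite: Balaban1985RegularSpaces, (1.93)–(1.94) p.92; Balaban1985BackgroundPropagators, (3.163) p.429] -/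
theorem firstTerm_H4 (h : Data Δ q qs A g c) (M : E →ₗ[ℝ] E) (l : E) (μ : F) (hl : q l = 0) :
    R325 q qs g c (M (Δ (l - H4 q qs A g c μ))) =
      printed194 Δ q qs g c M l -
        R325 q qs g c ((M - LinearMap.id : E →ₗ[ℝ] E) (g (qs (c (μ - q (g (qs (A μ)))))))) := by
  rw [firstTerm_eq h M l _ hl, lap_H4 h]
  congr 1
  have hM : M (g (qs (c (μ - q (g (qs (A μ))))))) =
      g (qs (c (μ - q (g (qs (A μ)))))) + (M - LinearMap.id : E →ₗ[ℝ] E) (g (qs (c (μ - q (g (qs (A μ))))))) := by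
    rw [LinearMap.sub_apply, LinearMap.id_apply, add_sub_cancel]
  rw [hM, map_add, R_g_qs_c h, zero_add]

/-- H′₍₄₎ − H′ = (I − H′Q′)G′Q′\*a : the two right inverses of Q′ differ by an N(Q′)-valued operator.
[cite: Balaban1985BackgroundPropagators, (3.163) p.429; Balaban1985RegularSpaces, (1.91) p.91] -/
theorem H4_sub_Hp (μ : F) :
    H4 q qs A g c μ - Hp qs g c μ = g (qs (A μ)) - Hp qs g c (q (g (qs (A μ)))) := by
  rw [H4_apply, map_sub]
  abel

/-- Q′(H′₍₄₎ − H′) = 0. [cite: Balaban1985BackgroundPropagators, (3.163) p.429; Balaban1985RegularSpaces, (1.91) p.91] -/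
theorem q_H4_sub_Hp (h : Data Δ q qs A g c) (μ : F) : q (H4 q qs A g c μ - Hp qs g c μ) = 0 := by
  rw [map_sub, q_H4 h, q_Hp h, sub_self]

/-- ΔH′₍₄₎μ ⟂ ΔN(Q′): the Euler–Lagrange orthogonality of the variational problem (3.164) solves.
[cite: Balaban1985BackgroundPropagators, (3.164) p.429] -/
theorem inner_lap_H4_lap_eq_zero (h : Data Δ q qs A g c) (μ : F) (ν : E) (hν : q ν = 0) :
    ⟪Δ (H4 q qs A g c μ), Δ ν⟫_ℝ = 0 := by
  rw [lap_H4 h, ← lapA_eq_of_ker Δ q qs A ν hν, h.g_symm, h.g_left, adj_symm h.adj, hν, inner_zero_right]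

/-- Pythagoras on the slice {Q′λ = μ}: ‖Δλ‖² = ‖ΔH′₍₄₎μ‖² + ‖Δ(λ − H′₍₄₎μ)‖².
[cite: Balaban1985BackgroundPropagators, (3.164) p.429] -/
theorem norm_lap_sq_eq_add_H4 (h : Data Δ q qs A g c) (μ : F) (l : E) (hl : q l = μ) :
    ‖Δ l‖ ^ 2 = ‖Δ (H4 q qs A g c μ)‖ ^ 2 + ‖Δ (l - H4 q qs A g c μ)‖ ^ 2 := by
  have hq : q (l - H4 q qs A g c μ) = 0 := by rw [map_sub, hl, q_H4 h, sub_self]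
  have horth : ⟪Δ (H4 q qs A g c μ), Δ (l - H4 q qs A g c μ)⟫_ℝ = 0 := inner_lap_H4_lap_eq_zero h μ _ hq
  have hsplit : Δ l = Δ (H4 q qs A g c μ) + Δ (l - H4 q qs A g c μ) := by rw [map_sub, add_sub_cancel]
  rw [hsplit, sq, sq, sq]
  exact norm_add_sq_eq_norm_sq_add_norm_sq_real horth

/-- **(3.164): H′₍₄₎μ MINIMISES ‖Δλ‖² on {λ : Q′λ = μ}** — the operator of (3.163) is the mean of the Gaussian
e^{−(1/2)‖Δλ‖²} on the slice Q′λ = μ, i.e. the ‖Δ·‖-minimal right inverse of Q′ (matrix twin `B9H163.isMinimiser`,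
Gaussian-mean step `B9H163.h164_mean`); whereas (1.91)'s H′μ minimises ‖Δ′_aλ‖² on the same slice (r05
`B8Eq191Hprime.norm_lapA_Hp_sq_le`). [cite: Balaban1985BackgroundPropagators, (3.163)–(3.164) p.429] -/
theorem norm_lap_H4_sq_le (h : Data Δ q qs A g c) (μ : F) (l : E) (hl : q l = μ) :
    ‖Δ (H4 q qs A g c μ)‖ ^ 2 ≤ ‖Δ l‖ ^ 2 := by
  rw [norm_lap_sq_eq_add_H4 h μ l hl]
  exact le_add_of_nonneg_right (sq_nonneg _)

/-- Uniqueness of the ‖Δ·‖-minimiser when Δ is injective on N(Q′) (Dirichlet conditions on Ω₀ᶜ): a competitor with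
Q′λ = μ and ‖Δλ‖² ≤ ‖ΔH′₍₄₎μ‖² IS H′₍₄₎μ — «the configuration λ₀ is determined uniquely».
[cite: Balaban1985BackgroundPropagators, (3.163)–(3.164) p.429] -/
theorem eq_H4_of_isMin (h : Data Δ q qs A g c) (hinj : ∀ l : E, q l = 0 → Δ l = 0 → l = 0) (μ : F) (l : E)
    (hl : q l = μ) (hmin : ‖Δ l‖ ^ 2 ≤ ‖Δ (H4 q qs A g c μ)‖ ^ 2) : l = H4 q qs A g c μ := by
  have hsplit := norm_lap_sq_eq_add_H4 h μ l hl
  have h0 : ‖Δ (l - H4 q qs A g c μ)‖ ^ 2 = 0 :=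
    le_antisymm (by linarith [sq_nonneg ‖Δ (H4 q qs A g c μ)‖]) (sq_nonneg _)
  have h1 : Δ (l - H4 q qs A g c μ) = 0 := by rwa [sq_eq_zero_iff, norm_eq_zero] at h0
  have hq : q (l - H4 q qs A g c μ) = 0 := by rw [map_sub, hl, q_H4 h, sub_self]
  exact sub_eq_zero.mp (hinj _ hq h1)

/-- «λ₀ is determined uniquely by the two conditions» Q′λ₀ = μ, RΔλ₀ = 0 — when Δ is injective on N(Q′) (matrix twin
`B9H163.unique_of_conditions`). [cite: Balaban1985BackgroundPropagators, (3.162)–(3.163) p.429] -/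
theorem eq_H4_of_conditions (h : Data Δ q qs A g c) (hinj : ∀ l : E, q l = 0 → Δ l = 0 → l = 0) (μ : F) (l : E)
    (hl : q l = μ) (hR : R325 q qs g c (Δ l) = 0) : l = H4 q qs A g c μ := by
  have hq : q (l - H4 q qs A g c μ) = 0 := by rw [map_sub, hl, q_H4 h, sub_self]
  have hRsub : R325 q qs g c (Δ (l - H4 q qs A g c μ)) = 0 := by
    rw [map_sub, map_sub, hR, R_lap_H4 h, sub_zero]
  have hfix : R325 q qs g c (Δ (l - H4 q qs A g c μ)) = Δ (l - H4 q qs A g c μ) := h.R325_lap _ hq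
  have h1 : Δ (l - H4 q qs A g c μ) = 0 := by rw [← hfix, hRsub]
  exact sub_eq_zero.mp (hinj _ hq h1)

/-! ### 4. When do the two right inverses coincide? -/

/-- **RQ′\* = 0 ⟺ Q′ΔN(Q′) = 0** (Δ maps N(Q′) into N(Q′)): R is the orthogonal projection onto ΔN(Q′) ([4] (3.21),
`B9Eq325Proj.Data.R325_mem`/`inner_sub_R325`), so Q′\*φ ∈ ker R iff Q′\*φ ⟂ ΔN(Q′) iff φ ⟂ Q′ΔN(Q′).
[cite: Balaban1985BackgroundPropagators, (3.21) p.394, (3.25) p.394] -/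
theorem forall_R_qs_eq_zero_iff (h : Data Δ q qs A g c) :
    (∀ φ : F, R325 q qs g c (qs φ) = 0) ↔ ∀ l : E, q l = 0 → q (Δ l) = 0 := by
  constructor
  · intro hR l hl
    have key : ∀ φ : F, ⟪φ, q (Δ l)⟫_ℝ = 0 := fun φ => by
      rw [← adj_symm h.adj]
      have h1 := h.inner_sub_R325 (qs φ) (Δ l) ((mem_lapKer Δ q _).mpr ⟨l, hl, rfl⟩)
      rwa [hR φ, sub_zero] at h1
    exact inner_self_eq_zero.mp (key _)
  · intro hc φ
    obtain ⟨l₀, hl₀, hv⟩ := (mem_lapKer Δ q _).mp (h.R325_mem (qs φ))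
    have h2 : ⟪qs φ, R325 q qs g c (qs φ)⟫_ℝ = 0 := by
      rw [hv, adj_symm h.adj, hc l₀ hl₀, inner_zero_right]
    have h3 : ⟪R325 q qs g c (qs φ), R325 q qs g c (qs φ)⟫_ℝ = 0 := by
      rw [h.R325_symm, h.R325_idem, h2]
    exact inner_self_eq_zero.mp h3

/-- If Q′ΔN(Q′) = 0 then G′Q′\*ψ already lies in Ran H′ = Ran G′²Q′\*: G′Q′\*ψ = H′(Q′G′Q′\*ψ) (H′ of (1.91)).
[cite: Balaban1985RegularSpaces, (1.91) p.91; Balaban1985BackgroundPropagators, (3.25) p.394] -/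
theorem g_qs_eq_Hp_of_criterion (h : Data Δ q qs A g c) (hc : ∀ l : E, q l = 0 → q (Δ l) = 0) (ψ : F) :
    g (qs ψ) = Hp qs g c (q (g (qs ψ))) := by
  set u : E := g (qs ψ) - Hp qs g c (q (g (qs ψ))) with hu_def
  have hu : q u = 0 := by rw [hu_def, map_sub, q_Hp h, sub_self]
  have hw : lapA Δ q qs A u = qs ψ - g (qs (c (q (g (qs ψ))))) := by
    rw [hu_def, map_sub, h.g_right, lapA_Hp h]
  have hΔu : lapA Δ q qs A u = Δ u := lapA_eq_of_ker Δ q qs A u hu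
  have hRw : R325 q qs g c (lapA Δ q qs A u) = lapA Δ q qs A u := by
    rw [hΔu]
    exact h.R325_lap u hu
  have hR0 : R325 q qs g c (lapA Δ q qs A u) = 0 := by
    rw [hw, map_sub, (forall_R_qs_eq_zero_iff h).mpr hc ψ, R_g_qs_c h, sub_self]
  have hlap : lapA Δ q qs A u = 0 := by rw [← hRw, hR0]
  have hu0 : u = 0 := by rw [← h.g_left u, hlap, map_zero]
  exact sub_eq_zero.mp hu0

/-- **If Q′ΔN(Q′) = 0 the two right inverses coincide**: H′₍₄₎ = H′ ((3.163) = (1.91)).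
[cite: Balaban1985BackgroundPropagators, (3.163) p.429; Balaban1985RegularSpaces, (1.91) p.91] -/
theorem H4_eq_Hp_of_criterion (h : Data Δ q qs A g c) (hc : ∀ l : E, q l = 0 → q (Δ l) = 0) (μ : F) :
    H4 q qs A g c μ = Hp qs g c μ := by
  have e := g_qs_eq_Hp_of_criterion h hc (A μ)
  rw [← sub_eq_zero, H4_sub_Hp, sub_eq_zero]
  exact e

/-- Converse mechanism: if G′Q′\*ψ = H′(Q′G′Q′\*ψ) for every ψ then RQ′\* = 0, hence Q′ΔN(Q′) = 0.
[cite: Balaban1985RegularSpaces, (1.91) p.91; Balaban1985BackgroundPropagators, (3.25) p.394] -/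
theorem criterion_of_g_qs_eq_Hp (h : Data Δ q qs A g c) (hH : ∀ ψ : F, g (qs ψ) = Hp qs g c (q (g (qs ψ)))) :
    ∀ l : E, q l = 0 → q (Δ l) = 0 := by
  refine (forall_R_qs_eq_zero_iff h).mp fun φ => ?_
  have e : qs φ = g (qs (c (q (g (qs φ))))) := by
    have h1 := congrArg (lapA Δ q qs A) (hH φ)
    rwa [h.g_right, lapA_Hp h] at h1
  rw [e, R_g_qs_c h]

/-- **H′₍₄₎ = H′ ⟹ Q′ΔN(Q′) = 0** for a onto (in finite dimension: the positive a_j of (3.24)) — with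
`H4_eq_Hp_of_criterion`: the operators (1.91) and (3.163) coincide IFF Δ maps N(Q′) into N(Q′).
[cite: Balaban1985BackgroundPropagators, (3.163) p.429; Balaban1985RegularSpaces, (1.91) p.91] -/
theorem criterion_of_H4_eq_Hp (h : Data Δ q qs A g c) (hA : Function.Surjective A)
    (hH : ∀ μ : F, H4 q qs A g c μ = Hp qs g c μ) : ∀ l : E, q l = 0 → q (Δ l) = 0 := by
  refine criterion_of_g_qs_eq_Hp h fun ψ => ?_
  obtain ⟨μ, rfl⟩ := hA ψ
  have h1 := hH μ
  rw [← sub_eq_zero, H4_sub_Hp, sub_eq_zero] at h1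
  exact h1

/-- For (1.91)'s H′: **RΔH′ = 0 (for every source) ⟺ Q′ΔN(Q′) = 0** (a onto) — the exact condition under which
the display (1.94) at M = I is literally the first term of (1.93) for every D′.
[cite: Balaban1985RegularSpaces, (1.91) p.91, (1.93)–(1.94) p.92] -/
theorem R_lap_Hp_eq_zero_iff (h : Data Δ q qs A g c) (hA : Function.Surjective A) :
    (∀ X : F, R325 q qs g c (Δ (Hp qs g c X)) = 0) ↔ ∀ l : E, q l = 0 → q (Δ l) = 0 := by
  constructor
  · intro hX
    refine (forall_R_qs_eq_zero_iff h).mp fun φ => ?_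
    obtain ⟨X, rfl⟩ := hA φ
    have h1 := hX X
    rwa [R_lap_Hp h, neg_eq_zero] at h1
  · intro hc X
    rw [R_lap_Hp h, neg_eq_zero]
    exact (forall_R_qs_eq_zero_iff h).mpr hc (A X)

end Abstract

/-! ## §2  Witness: the periodic two-block system with six sites (d = 1, L = 3, flat U₀, 𝔤 = ℝ, a = 1) -/

namespace Witness6

/-- L²(Ω₀, 𝔤) for Ω₀ = T_η = the one-dimensional torus with 6 sites, 𝔤 = ℝ (unweighted ℓ², cell DIVERGENCE D-b09.24).
[folklore] -/
abbrev E6 := EuclideanSpace ℝ (Fin 6)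

/-- L²(𝔅) for the unit lattice 𝔅 = Λ₁ = two points (blocks {0,1,2} and {3,4,5}, L = 3). [folklore] -/
abbrev F2 := EuclideanSpace ℝ (Fin 2)

/-- Δ = D\*D ([4] (3.23)) on the 6-site torus at the flat background U₀ = 1: the cyclic graph Laplacian.
[cite: Balaban1985BackgroundPropagators, (3.23) p.394] -/
def lapMat : Matrix (Fin 6) (Fin 6) ℝ :=
  !![2, -1, 0, 0, 0, -1;
     -1, 2, -1, 0, 0, 0;
     0, -1, 2, -1, 0, 0;
     0, 0, -1, 2, -1, 0;
     0, 0, 0, -1, 2, -1;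
     -1, 0, 0, 0, -1, 2]

/-- Q′ ([4] (3.19)) at U₀ = 1, L = 3, d = 1: the two block means with weights L^{−d} = 1/3.
[cite: Balaban1985BackgroundPropagators, (3.19) p.393] -/
def avgMat : Matrix (Fin 2) (Fin 6) ℝ :=
  !![1/3, 1/3, 1/3, 0, 0, 0;
     0, 0, 0, 1/3, 1/3, 1/3]

/-- Δ as an operator on ℓ²(6 sites). [cite: Balaban1985BackgroundPropagators, (3.23) p.394] -/
def Δ6 : E6 →ₗ[ℝ] E6 := Matrix.toEuclideanLin lapMat

/-- Q′ as an operator ℓ²(6 sites) → ℓ²(2 blocks). [cite: Balaban1985BackgroundPropagators, (3.19) p.393] -/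
def q6 : E6 →ₗ[ℝ] F2 := Matrix.toEuclideanLin avgMat

/-- Q′\* = the ℓ²-adjoint of Q′ ([4] p. 393; (3.24)). [cite: Balaban1985BackgroundPropagators, (3.24) p.394] -/
def qs6 : F2 →ₗ[ℝ] E6 := Matrix.toEuclideanLin avgMat.conjTranspose

/-- the Laplacian matrix is symmetric. [folklore] -/
private theorem lapMat_isHermitian : lapMat.IsHermitian := by
  apply Matrix.IsHermitian.ext
  intro i j
  fin_cases i <;> fin_cases j <;> simp [lapMat]

/-- Δ is symmetric ([4] p. 392 «a hermitian operator»). [cite: Balaban1985BackgroundPropagators, (3.23) p.394] -/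
theorem Δ6_symm (x y : E6) : ⟪Δ6 x, y⟫_ℝ = ⟪x, Δ6 y⟫_ℝ :=
  (Matrix.isSymmetric_toEuclideanLin_iff.mpr lapMat_isHermitian) x y

/-- Q′\* is the adjoint of Q′. [cite: Balaban1985BackgroundPropagators, (3.24) p.394] -/
theorem q6_adj (x : E6) (φ : F2) : ⟪q6 x, φ⟫_ℝ = ⟪x, qs6 φ⟫_ℝ := by
  rw [qs6, Matrix.toEuclideanLin_conjTranspose_eq_adjoint, LinearMap.adjoint_inner_right]
  rfl

/-- unfolding of Δ. [folklore] -/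
private theorem Δ6_apply (x : E6) : Δ6 x = WithLp.toLp 2 (lapMat.mulVec (WithLp.ofLp x)) := rfl

/-- unfolding of Q′. [folklore] -/
private theorem q6_apply (x : E6) : q6 x = WithLp.toLp 2 (avgMat.mulVec (WithLp.ofLp x)) := rfl

/-- unfolding of Q′\*. [folklore] -/
private theorem qs6_apply (φ : F2) : qs6 φ = WithLp.toLp 2 (avgMat.conjTranspose.mulVec (WithLp.ofLp φ)) := rfl

/-- ⟨λ, Δλ⟩ = ‖Dλ‖² = the sum of the squared bond differences around the torus ([4] (3.23) Δ = D\*D).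
[cite: Balaban1985BackgroundPropagators, (3.23) p.394] -/
theorem inner_Δ6 (x : E6) :
    ⟪x, Δ6 x⟫_ℝ = (x 0 - x 1) ^ 2 + (x 1 - x 2) ^ 2 + (x 2 - x 3) ^ 2 + (x 3 - x 4) ^ 2 + (x 4 - x 5) ^ 2
      + (x 5 - x 0) ^ 2 := by
  rw [EuclideanSpace.inner_eq_star_dotProduct, Δ6_apply]
  simp [dotProduct, Matrix.mulVec, Fin.sum_univ_succ, lapMat]
  ring

/-- ⟨λ, Δλ⟩ ≥ 0. [cite: Balaban1985BackgroundPropagators, (3.23) p.394] -/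
theorem Δ6_nonneg (x : E6) : 0 ≤ ⟪x, Δ6 x⟫_ℝ := by
  rw [inner_Δ6]; positivity

/-- (Q′λ)(first block) = (λ₀ + λ₁ + λ₂)/3. [cite: Balaban1985BackgroundPropagators, (3.19) p.393] -/
theorem q6_apply_zero (x : E6) : q6 x 0 = 1 / 3 * x 0 + 1 / 3 * x 1 + 1 / 3 * x 2 := by
  rw [q6_apply]
  simp [Matrix.mulVec, dotProduct, Fin.sum_univ_succ, avgMat]
  ring

/-- (Q′λ)(second block) = (λ₃ + λ₄ + λ₅)/3. [cite: Balaban1985BackgroundPropagators, (3.19) p.393] -/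
theorem q6_apply_one (x : E6) : q6 x 1 = 1 / 3 * x 3 + 1 / 3 * x 4 + 1 / 3 * x 5 := by
  rw [q6_apply]
  simp [Matrix.mulVec, dotProduct, Fin.sum_univ_succ, avgMat]
  ring

/-- (Q′\*φ)(site 0) = φ(first block)/3. [cite: Balaban1985BackgroundPropagators, (3.24) p.394] -/
theorem qs6_apply_zero (φ : F2) : qs6 φ 0 = 1 / 3 * φ 0 := by
  rw [qs6_apply]
  simp [Matrix.mulVec, dotProduct, Fin.sum_univ_succ, avgMat, Matrix.conjTranspose]

/-- (Q′\*φ)(site 3) = φ(second block)/3. [cite: Balaban1985BackgroundPropagators, (3.24) p.394] -/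
theorem qs6_apply_three (φ : F2) : qs6 φ 3 = 1 / 3 * φ 1 := by
  rw [qs6_apply]
  simp [Matrix.mulVec, dotProduct, Fin.sum_univ_succ, avgMat, Matrix.conjTranspose]

/-- Q′\* is injective (Q′ is onto, [4] p. 393). [cite: Balaban1985BackgroundPropagators, (3.19) p.393] -/
theorem qs6_injective : Function.Injective qs6 := by
  intro φ ψ hφψ
  have h0 := congrArg (fun z : E6 => z 0) hφψ
  have h3 := congrArg (fun z : E6 => z 3) hφψ
  simp only [qs6_apply_zero, qs6_apply_three] at h0 h3
  ext i
  fin_cases i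
  · simpa using (by linarith : φ 0 = ψ 0)
  · simpa using (by linarith : φ 1 = ψ 1)

/-- The kernel condition of Theorem 3.11's "obvious" clause on this system: ⟨λ, Δλ⟩ = 0 and Q′λ = 0 force λ = 0
(Dλ = 0 ⇒ λ constant around the torus; zero block mean ⇒ λ = 0). [cite: Balaban1985BackgroundPropagators, Thm 3.11 p.416] -/
theorem ker6 (x : E6) (h0 : ⟪x, Δ6 x⟫_ℝ = 0) (hq : q6 x = 0) : x = 0 := by
  rw [inner_Δ6] at h0
  have hq0 : q6 x 0 = 0 := by rw [hq]; rfl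
  rw [q6_apply_zero] at hq0
  have e01 : (x 0 - x 1) ^ 2 = 0 := by
    nlinarith [sq_nonneg (x 0 - x 1), sq_nonneg (x 1 - x 2), sq_nonneg (x 2 - x 3), sq_nonneg (x 3 - x 4),
      sq_nonneg (x 4 - x 5), sq_nonneg (x 5 - x 0)]
  have e12 : (x 1 - x 2) ^ 2 = 0 := by
    nlinarith [sq_nonneg (x 0 - x 1), sq_nonneg (x 1 - x 2), sq_nonneg (x 2 - x 3), sq_nonneg (x 3 - x 4),
      sq_nonneg (x 4 - x 5), sq_nonneg (x 5 - x 0)]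
  have e23 : (x 2 - x 3) ^ 2 = 0 := by
    nlinarith [sq_nonneg (x 0 - x 1), sq_nonneg (x 1 - x 2), sq_nonneg (x 2 - x 3), sq_nonneg (x 3 - x 4),
      sq_nonneg (x 4 - x 5), sq_nonneg (x 5 - x 0)]
  have e34 : (x 3 - x 4) ^ 2 = 0 := by
    nlinarith [sq_nonneg (x 0 - x 1), sq_nonneg (x 1 - x 2), sq_nonneg (x 2 - x 3), sq_nonneg (x 3 - x 4),
      sq_nonneg (x 4 - x 5), sq_nonneg (x 5 - x 0)]
  have e45 : (x 4 - x 5) ^ 2 = 0 := by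
    nlinarith [sq_nonneg (x 0 - x 1), sq_nonneg (x 1 - x 2), sq_nonneg (x 2 - x 3), sq_nonneg (x 3 - x 4),
      sq_nonneg (x 4 - x 5), sq_nonneg (x 5 - x 0)]
  have h01 : x 0 = x 1 := sub_eq_zero.mp ((pow_eq_zero_iff two_ne_zero).mp e01)
  have h12 : x 1 = x 2 := sub_eq_zero.mp ((pow_eq_zero_iff two_ne_zero).mp e12)
  have h23 : x 2 = x 3 := sub_eq_zero.mp ((pow_eq_zero_iff two_ne_zero).mp e23)
  have h34 : x 3 = x 4 := sub_eq_zero.mp ((pow_eq_zero_iff two_ne_zero).mp e34)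
  have h45 : x 4 = x 5 := sub_eq_zero.mp ((pow_eq_zero_iff two_ne_zero).mp e45)
  have hx0 : x 0 = 0 := by linarith
  ext i
  fin_cases i <;> simp <;> linarith

/-- a = 1 (the identity of L²(𝔅)) is positive definite. [cite: Balaban1985BackgroundPropagators, (3.24) p.394] -/
theorem id_posDef : PosDef (LinearMap.id : F2 →ₗ[ℝ] F2) := fun _ hx => real_inner_self_pos.mpr hx

/-- **The (3.25) data EXIST on this system** (G′ = (Δ + Q′\*Q′)⁻¹ and (Q′G′²Q′\*)⁻¹ with every printed property), by the
audit cell's `B9Thm311Data.exists_data_of_ingredients` — so all of §1 applies to it non-vacuously.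
[cite: Balaban1985BackgroundPropagators, Thm 3.11 p.416, (3.24)–(3.25) p.394] -/
theorem exists_data6 : ∃ (g : E6 →ₗ[ℝ] E6) (c : F2 →ₗ[ℝ] F2), Data Δ6 q6 qs6 LinearMap.id g c := by
  obtain ⟨g, c, hD, -⟩ := exists_data_of_ingredients Δ6_symm q6_adj (fun _ _ => rfl) Δ6_nonneg id_posDef ker6
    qs6_injective
  exact ⟨g, c, hD⟩

/-- the witness λ = δ₀ − δ₁ ∈ N(Q′). [folklore] -/
def lam6 : E6 := WithLp.toLp 2 ![1, -1, 0, 0, 0, 0]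

/-- Q′λ = 0 for the witness. [cite: Balaban1985BackgroundPropagators, (3.19) p.393] -/
theorem q6_lam6 : q6 lam6 = 0 := by
  ext i
  fin_cases i <;> simp [q6_apply, avgMat, lam6]

/-- (Q′Δλ)(first block) = 1/3 for the witness: the bond ⟨5, 0⟩ joining the two blocks carries the flux of Δλ out of the
block. [cite: Balaban1985BackgroundPropagators, (3.19) p.393, (3.23) p.394] -/
theorem q6_Δ6_lam6_zero : q6 (Δ6 lam6) 0 = 1 / 3 := by
  rw [q6_apply_zero, Δ6_apply]
  simp [Matrix.mulVec, dotProduct, Fin.sum_univ_succ, lapMat, lam6]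
  norm_num

/-- Q′Δλ ≠ 0 for the witness. [cite: Balaban1985BackgroundPropagators, (3.19) p.393, (3.23) p.394] -/
theorem q6_Δ6_lam6_ne_zero : q6 (Δ6 lam6) ≠ 0 := by
  intro h
  have h0 := congrArg (fun z : F2 => z 0) h
  simp only [q6_Δ6_lam6_zero] at h0
  norm_num at h0

/-- **The criterion Q′ΔN(Q′) = 0 FAILS** on the six-site two-block torus: Δ does not map N(Q′) into N(Q′).
[cite: Balaban1985BackgroundPropagators, (3.19) p.393, (3.23) p.394] -/
theorem criterion_fails6 : ¬ ∀ l : E6, q6 l = 0 → q6 (Δ6 l) = 0 :=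
  fun hc => q6_Δ6_lam6_ne_zero (hc lam6 q6_lam6)

variable {g : E6 →ₗ[ℝ] E6} {c : F2 →ₗ[ℝ] F2}

/-- Hence, for the (3.25) data of this system: RQ′\* ≠ 0. [cite: Balaban1985BackgroundPropagators, (3.25) p.394] -/
theorem exists_R_qs_ne_zero6 (h : Data Δ6 q6 qs6 LinearMap.id g c) :
    ∃ φ : F2, R325 q6 qs6 g c (qs6 φ) ≠ 0 :=
  not_forall.mp fun hR => criterion_fails6 ((forall_R_qs_eq_zero_iff h).mp hR)

/-- For the H′ of (1.91) on this system: **RΔH′X ≠ 0 for some source X** — the H′D′-part of the first term of (1.93) is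
not killed by R. [cite: Balaban1985RegularSpaces, (1.91) p.91, (1.93)–(1.94) p.92] -/
theorem exists_R_lap_Hp_ne_zero6 (h : Data Δ6 q6 qs6 LinearMap.id g c) :
    ∃ X : F2, R325 q6 qs6 g c (Δ6 (Hp qs6 g c X)) ≠ 0 :=
  not_forall.mp fun hX =>
    criterion_fails6 ((R_lap_Hp_eq_zero_iff h Function.surjective_id).mp hX)

/-- **(1.91) ≠ (3.163) on this system**: the H′ of B8 (1.91) and the H′ of [4] (3.163)–(3.164) are different right
inverses of Q′. [cite: Balaban1985RegularSpaces, (1.91) p.91; Balaban1985BackgroundPropagators, (3.163)–(3.164) p.429] -/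
theorem exists_Hp_ne_H4_6 (h : Data Δ6 q6 qs6 LinearMap.id g c) :
    ∃ μ : F2, Hp qs6 g c μ ≠ H4 q6 qs6 LinearMap.id g c μ := by
  obtain ⟨μ, hμ⟩ := not_forall.mp fun hH =>
    criterion_fails6 (criterion_of_H4_eq_Hp h Function.surjective_id hH)
  exact ⟨μ, fun e => hμ e.symm⟩

/-- **The display (1.94) is not literally the first term of (1.93)** on this system (M = I, λ = 0, D′ = X with
RQ′\*X ≠ 0): R·Δ(λ − H′X) ≠ [I + R(M − I)R]Δλ — the difference is the term p. 93 then bounds inside 𝔉₄.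
[cite: Balaban1985RegularSpaces, (1.93)–(1.94) p.92, p.93 (before (1.99))] -/
theorem rewriting194_fails6 (h : Data Δ6 q6 qs6 LinearMap.id g c) :
    ∃ X : F2, R325 q6 qs6 g c ((LinearMap.id : E6 →ₗ[ℝ] E6) (Δ6 ((0 : E6) - Hp qs6 g c X))) ≠
      printed194 Δ6 q6 qs6 g c LinearMap.id 0 := by
  obtain ⟨X, hX⟩ := exists_R_qs_ne_zero6 h
  refine ⟨X, fun e => hX ?_⟩
  rw [LinearMap.id_apply, printed194_id] at e
  exact (rewriting194_id_iff h 0 X (map_zero q6)).mp e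

end Witness6

end

end Literature.MathematicalPhysics.QuantumFieldTheory.Balaban1983to89.B8Eq194FirstTerm
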